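import Literature.AlgebraicTopology.SingularHomology.SingularChains
import Literature.AlgebraicTopology.SingularHomology.PoincareDuality
import Literature.AlgebraicTopology.SingularHomology.PoincareDualityCorollaries
import Literature.AlgebraicTopology.SingularHomology.IntersectionFormProofs
import Literature.AlgebraicTopology.SingularHomology.CohomologyFiniteness
import Literature.AlgebraicTopology.SingularHomology.CompactManifoldFiniteness
import Literature.AlgebraicTopology.SingularHomology.CupProduct
import Literature.Topology.FourManifolds.IntersectionLatticeProofs
import Literature.Topology.FourManifolds.TrisectionFunctorSPC4Proofs
import Literature.Geometry.Kaehler.ManifoldFormsPullback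

/-! # Rank-one lattice bookkeeping of a door — helper of stub `stub_taubesCanonicalCurve`
(line `canonical-cap-filling`, crux `NoGenusTwoDoor`, stmt-SmoothPoincare4-7842, route
SymplecticOrigami)

A DOOR is a closed connected `4`-manifold `N` with `rank H₁(N; ℤ) = 2`, `rank H₂(N; ℤ) = 1`.
Given a `ℤ`-orientation `μ` with `b⁺(μ) ≥ 1` (the symplectic orientation), this file PROVES the
elementary (co)homological bookkeeping consumed by the Taubes step of the line:

* `nonempty_linearEquiv_int_of_finrank_eq_one`, `bilin_apply_eq_of_linearEquiv`,
  `apply_generator_self_eq_one` — a free `ℤ`-module `L` of rank one has a coordinate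
  `e : L ≃ ℤ` (generator `g = e⁻¹ 1`), every bilinear form is `Q(x, y) = e(x) e(y) Q(g, g)`, and
  a PERFECT form with `b⁺ ≥ 1` has `Q(g, g) = +1`;
* `linearMap_apply_eq_of_linearEquiv` — a torsion-blind additive functional on `H²(N; ℤ)`
  (e.g. the real-valued symplectic area) factors through the coordinate of `H²(N; ℤ)/T ≅ ℤ`;
* `finrank_freeCohomology_two_eq_one`, `sigPos_eq_one_and_sigNeg_eq_zero`,
  `signature_eq_one_of_door`, `relEuler_eq_neg_one_of_door`,
  `finrank_rat_singularCohomology_two_eq_one` — for a door: `rank H²(N; ℤ)/T = 1`,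
  `(b⁺, b⁻) = (1, 0)`, `σ(N, μ) = 1`, `χ(N) = 1 - 2 + 1 - 2 + 1 = -1`, `dim_ℚ H²(N; ℚ) = 1`.

Everything is proved from the tree's PROVED Poincaré duality, universal coefficients,
finiteness of the homology of compact manifolds and `b₂ = b⁺ + b⁻`
(`finrank_eq_sigPos_add_sigNeg_intersectionForm_holds`). Sources: Hatcher, *Algebraic Topology*
(2002) §3.1 Cor. 3.3, §3.3 Thm. 3.30, Prop. 3.38; Milnor–Husemoller (1973) §II, §V.1;
Gompf–Stipsicz (1999) §1.2.
-/

noncomputable section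
-- the prescribed namespace `Summit.<P>.<Sub>.…` duplicates `SmoothPoincare4` (P = Sub)
set_option linter.dupNamespace false
open scoped Manifold ContDiff Topology ContinuousMap
open Set Function TopologicalSpace
open Literature.Geometry.Kaehler (MForm IsSmoothForm IsClosedForm mextDeriv)
open Literature.AlgebraicTopology.SingularHomology
open Literature.Topology.FourManifolds (singularHomologyZ)

namespace Summit.SmoothPoincare4.SmoothPoincare4.Theorems.NoGenusTwoDoor.CanonicalCapFilling

universe u

/-! ### Rank-one lattices -/

section RankOne

variable {L : Type*} [AddCommGroup L] [Module ℤ L]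

/-- A free `ℤ`-module of rank one is `ℤ`: a coordinate isomorphism `e : L ≃ ℤ` (generator
`e⁻¹ 1`) (Milnor–Husemoller 1973, §I.1). [folklore] -/
theorem nonempty_linearEquiv_int_of_finrank_eq_one [Module.Finite ℤ L] [Module.Free ℤ L]
    (h : Module.finrank ℤ L = 1) : Nonempty (L ≃ₗ[ℤ] ℤ) :=
  ⟨LinearEquiv.ofFinrankEq L ℤ (by rw [h, Module.finrank_self])⟩

/-- Every bilinear form on `ℤ` is `B(a, b) = a b B(1, 1)`. [folklore] -/
theorem bilin_int_apply (B : ℤ →ₗ[ℤ] ℤ →ₗ[ℤ] ℤ) (a b : ℤ) : B a b = a * b * B 1 1 := by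
  have hB : B = B 1 1 • LinearMap.mul ℤ ℤ := by
    refine LinearMap.ext_ring (LinearMap.ext_ring ?_)
    simp
  conv_lhs => rw [hB]
  simp only [LinearMap.smul_apply, LinearMap.mul_apply', smul_eq_mul]
  ring

/-- On a rank-one lattice with coordinate `e`, every bilinear form is
`Q(x, y) = e(x) e(y) Q(g, g)`, `g = e⁻¹ 1` (Milnor–Husemoller 1973, §I.1). [folklore] -/
theorem bilin_apply_eq_of_linearEquiv (Q : LinearMap.BilinForm ℤ L) (e : L ≃ₗ[ℤ] ℤ) (x y : L) :
    Q x y = e x * e y * Q (e.symm 1) (e.symm 1) := by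
  have h := bilin_int_apply (Q.compl₁₂ (e.symm : ℤ →ₗ[ℤ] L) (e.symm : ℤ →ₗ[ℤ] L)) (e x) (e y)
  simpa only [LinearMap.compl₁₂_apply, LinearEquiv.coe_coe, LinearEquiv.symm_apply_apply] using h

/-- A PERFECT (unimodular) form on a rank-one lattice has `Q(g, g) = ±1` (Milnor–Husemoller
1973, §I.2: a unimodular rank-one lattice is `⟨+1⟩` or `⟨-1⟩`). [cite: MilnorHusemoller1973, §I.2] -/
theorem apply_generator_self_eq_one_or (Q : LinearMap.BilinForm ℤ L) (hQ : Q.IsPerfPair)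
    (e : L ≃ₗ[ℤ] ℤ) : Q (e.symm 1) (e.symm 1) = 1 ∨ Q (e.symm 1) (e.symm 1) = -1 := by
  obtain ⟨x, hx⟩ := (hQ.bijective_left).2 (e : L →ₗ[ℤ] ℤ)
  have h1 : Q x (e.symm 1) = 1 := by
    rw [hx, LinearEquiv.coe_coe, LinearEquiv.apply_symm_apply]
  rw [bilin_apply_eq_of_linearEquiv Q e, LinearEquiv.apply_symm_apply, mul_one, mul_comm] at h1
  exact Int.eq_one_or_neg_one_of_mul_eq_one h1

/-- A perfect form on a rank-one lattice with a positive vector (`b⁺ ≥ 1`, Mathlib's `sigPos`)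
is `⟨+1⟩`: `Q(g, g) = 1` (Milnor–Husemoller 1973, §I.2 and §II.2). [cite: MilnorHusemoller1973, §II.2] -/
theorem apply_generator_self_eq_one [Module.Finite ℤ L] (Q : LinearMap.BilinForm ℤ L)
    (hQ : Q.IsPerfPair) (hpos : 1 ≤ sigPos Q.toQuadraticMap) (e : L ≃ₗ[ℤ] ℤ) :
    Q (e.symm 1) (e.symm 1) = 1 := by
  rcases apply_generator_self_eq_one_or Q hQ e with h | h
  · exact h
  exfalso
  obtain ⟨V, hV, hVpos⟩ := exists_finrank_eq_sigPos_and_posDef Q.toQuadraticMap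
  have hVne : V ≠ ⊥ := by
    rintro rfl
    rw [finrank_bot] at hV
    omega
  obtain ⟨v, hvV, hv0⟩ := (Submodule.ne_bot_iff V).mp hVne
  have hv : (⟨v, hvV⟩ : V) ≠ 0 := fun h0 ↦ hv0 (congrArg Subtype.val h0)
  have hq := hVpos _ hv
  rw [QuadraticMap.restrict_apply, LinearMap.BilinMap.toQuadraticMap_apply,
    bilin_apply_eq_of_linearEquiv Q e, h] at hq
  nlinarith [mul_self_nonneg (e v)]

/-- A linear map into a torsion-free module kills torsion elements (Bourbaki, *Algèbre* II §7;
e.g. a real-valued additive functional on `H²(N; ℤ)`). [folklore] -/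
theorem linearMap_apply_eq_zero_of_mem_torsion {R : Type*} [CommRing R] [IsDomain R]
    {V W : Type*} [AddCommGroup V] [Module R V] [AddCommGroup W] [Module R W]
    [Module.IsTorsionFree R W] (f : V →ₗ[R] W) {x : V} (hx : x ∈ Submodule.torsion R V) :
    f x = 0 := by
  obtain ⟨⟨r, hr⟩, hrx⟩ := (Submodule.mem_torsion_iff x).mp hx
  have hr0 : r ≠ 0 := nonZeroDivisors.ne_zero hr
  have h : r • f x = 0 := by
    rw [← map_smul]
    exact (congrArg f hrx).trans (map_zero f)
  exact (smul_eq_zero_iff_right hr0).mp h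

/-- **A torsion-blind functional factors through a rank-one quotient.** Let `π : V → L` be
linear with `ker π ⊆ torsion V` (e.g. `H²(N; ℤ) → H²(N; ℤ)/T`), `e : L ≃ R` a coordinate and
`g'` a lift of the generator `e⁻¹ 1`. Then every linear `f : V → W` into a torsion-free `W`
(e.g. the real-valued symplectic area) satisfies `f(x) = e(π x) · f(g')`. [folklore] -/
theorem linearMap_apply_eq_of_linearEquiv {R : Type*} [CommRing R] [IsDomain R]
    {V W M : Type*} [AddCommGroup V] [Module R V] [AddCommGroup W] [Module R W]
    [Module.IsTorsionFree R W] [AddCommGroup M] [Module R M]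
    (f : V →ₗ[R] W) (π : V →ₗ[R] M) (hker : LinearMap.ker π ≤ Submodule.torsion R V)
    (e : M ≃ₗ[R] R) (g' : V) (hg' : π g' = e.symm 1) (x : V) :
    f x = e (π x) • f g' := by
  set T : V →ₗ[R] V := ((e : M →ₗ[R] R).comp π).smulRight g' with hT
  have hx : x - T x ∈ Submodule.torsion R V := by
    apply hker
    rw [LinearMap.mem_ker, map_sub, hT, LinearMap.smulRight_apply, map_smul, hg', ← map_smul,
      LinearMap.comp_apply, LinearEquiv.coe_coe, smul_eq_mul, mul_one,
      LinearEquiv.symm_apply_apply, sub_self]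
  have h0 := linearMap_apply_eq_zero_of_mem_torsion f hx
  rw [map_sub, sub_eq_zero, hT, LinearMap.smulRight_apply, map_smul, LinearMap.comp_apply,
    LinearEquiv.coe_coe] at h0
  exact h0

end RankOne

/-! ### The (co)homological numerics of a door -/

section Door

variable {N : Type u} [TopologicalSpace N] [T2Space N] [CompactSpace N] [ChartedSpace (EuclideanSpace ℝ (Fin 4)) N]

/-- For a closed `4`-manifold with `rank H₂(N; ℤ) = 1`, the lattice `H²(N; ℤ)/T` has rank one
(Hatcher 2002, §3.1 Cor. 3.3 and §3.A Cor. 3A.6: `rank H²/T = b₂(ℚ) = rank H₂(ℤ)`; the tree's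
proved `finrank_freeCohomology_eq_bettiNumber_holds`, `bettiNumber_int_eq_rat`).
[cite: HatcherAT2002, §3.1 Cor. 3.3] -/
theorem finrank_freeCohomology_two_eq_one
    (hb2 : Module.finrank ℤ (singularHomology ℤ ℤ N 2) = 1) :
    Module.finrank ℤ (freeCohomology ℤ N 2) = 1 := by
  have h := finrank_freeCohomology_eq_bettiNumber_holds (X := N) (n := 4) 2
  unfold finrank_freeCohomology_eq_bettiNumber at h
  rw [h, ← bettiNumber_int_eq_rat]
  exact hb2

/-- For a closed `4`-manifold with `rank H₂(N; ℤ) = 1`, `dim_ℚ H²(N; ℚ) = 1` (universal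
coefficients over the field `ℚ`, Hatcher 2002, §3.1 Cor. 3.3, and `b₂(ℚ) = rank H₂(ℤ)`,
§3.A Cor. 3A.6; the tree's proved `finrank_singularCohomology_eq_finrank_singularHomology`,
`bettiNumber_int_eq_rat`). [cite: HatcherAT2002, §3.1 Cor. 3.3 and §3.A Cor. 3A.6] -/
theorem finrank_rat_singularCohomology_two_eq_one
    (hb2 : Module.finrank ℤ (singularHomology ℤ ℤ N 2) = 1) :
    Module.finrank ℚ (singularCohomology ℚ ℚ N 2) = 1 := by
  haveI : ∀ m, Module.Finite ℚ (singularHomology ℚ ℚ N m) := fun m ↦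
    finite_singularHomology_of_compact_chartedSpace ℚ ℚ (d := 4) m
  rw [finrank_singularCohomology_eq_finrank_singularHomology ℚ N 2 (fun _ _ ↦ inferInstance)]
  change bettiNumber ℚ N 2 = 1
  rw [← bettiNumber_int_eq_rat]
  exact hb2

/-- For a closed `ℤ`-oriented `4`-manifold with `rank H₂(N; ℤ) = 1` and `b⁺ ≥ 1`:
`(b⁺, b⁻) = (1, 0)` (`b₂ = b⁺ + b⁻`, Gompf–Stipsicz 1999, §1.2; the tree's proved
`finrank_eq_sigPos_add_sigNeg_intersectionForm_holds`). [cite: GompfStipsiczGSM1999, §1.2] -/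
theorem sigPos_eq_one_and_sigNeg_eq_zero (μ : HomologicalOrientation ℤ N 4)
    (hpos : 1 ≤ sigPos (intersectionForm two_add_two_eq_four μ).toQuadraticMap)
    (hb2 : Module.finrank ℤ (singularHomology ℤ ℤ N 2) = 1) :
    sigPos (intersectionForm two_add_two_eq_four μ).toQuadraticMap = 1 ∧
      sigNeg (intersectionForm two_add_two_eq_four μ).toQuadraticMap = 0 := by
  have h := Literature.Topology.FourManifolds.finrank_eq_sigPos_add_sigNeg_intersectionForm_holds
    (X := N) (k := 2) (n := 4) even_two two_add_two_eq_four μ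
  rw [finrank_freeCohomology_two_eq_one hb2] at h
  omega

/-- For a closed `ℤ`-oriented `4`-manifold with `rank H₂(N; ℤ) = 1` and `b⁺ ≥ 1`, the signature
is `σ(N, μ) = b⁺ - b⁻ = 1` (Gompf–Stipsicz 1999, §1.2). [cite: GompfStipsiczGSM1999, §1.2] -/
theorem signature_eq_one_of_door (μ : HomologicalOrientation ℤ N 4)
    (hpos : 1 ≤ sigPos (intersectionForm two_add_two_eq_four μ).toQuadraticMap)
    (hb2 : Module.finrank ℤ (singularHomology ℤ ℤ N 2) = 1) : μ.signature = 1 := by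
  obtain ⟨h1, h0⟩ := sigPos_eq_one_and_sigNeg_eq_zero μ hpos hb2
  simp only [HomologicalOrientation.signature, LinearMap.BilinForm.signature, h1, h0]
  norm_num

/-- For a closed `ℤ`-oriented `4`-manifold, `rank H₃(N; ℤ) = rank H₁(N; ℤ)` (Poincaré duality
`H₃ ≅ H¹`, Hatcher 2002, Thm. 3.30, and `rank H¹ = rank H₁`, §3.1 Cor. 3.3; both PROVED in the
tree). [cite: HatcherAT2002, Thm. 3.30 and §3.1 Cor. 3.3] -/
theorem finrank_singularHomology_three_eq_finrank_one (μ : HomologicalOrientation ℤ N 4) :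
    Module.finrank ℤ (singularHomology ℤ ℤ N 3) = Module.finrank ℤ (singularHomology ℤ ℤ N 1) := by
  haveI : ∀ m, Module.Finite ℤ (singularHomology ℤ ℤ N m) := fun m ↦
    finite_singularHomology_of_compact_chartedSpace ℤ ℤ (d := 4) m
  let D : singularCohomology ℤ ℤ N 1 ≃ₗ[ℤ] singularHomology ℤ ℤ N 3 :=
    poincareDualityEquiv μ (show 1 + 3 = 4 by norm_num) (poincare_duality μ _)
  rw [← D.finrank_eq,
    finrank_singularCohomology_eq_finrank_singularHomology ℤ N 1 (fun _ _ ↦ inferInstance)]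

/-- **Euler characteristic of a door**: a closed connected `ℤ`-oriented `4`-manifold with
`rank H₁(N; ℤ) = 2`, `rank H₂(N; ℤ) = 1` has `χ(N) = 1 - 2 + 1 - 2 + 1 = -1`
(`χ = Σ (-1)^k rank H_k`, Hatcher 2002, §2.2 p. 146; `rank H₀ = rank H₄ = 1`, Thm. 3.26;
`rank H₃ = rank H₁`, Thm. 3.30). [cite: HatcherAT2002, §2.2 p. 146, Thm. 3.26 and Thm. 3.30] -/
theorem relEuler_eq_neg_one_of_door [ConnectedSpace N] (μ : HomologicalOrientation ℤ N 4)
    (hb1 : Module.finrank ℤ (singularHomology ℤ ℤ N 1) = 2)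
    (hb2 : Module.finrank ℤ (singularHomology ℤ ℤ N 2) = 1) :
    relEuler ℤ ℤ N ∅ = -1 := by
  have h0 : Module.finrank ℤ (singularHomology ℤ ℤ N 0) = 1 :=
    Literature.Topology.FourManifolds.finrank_singularHomology_zero_eq_one_of_connected_four
  have h3 : Module.finrank ℤ (singularHomology ℤ ℤ N 3) = 2 := by
    rw [finrank_singularHomology_three_eq_finrank_one μ, hb1]
  have h4 : Module.finrank ℤ (singularHomology ℤ ℤ N 4) = 1 :=
    Literature.Topology.FourManifolds.finrank_singularHomology_four_eq_one μ
  rw [(Literature.Topology.FourManifolds.finRelHomology_of_compactSpace_four N).relEuler_empty_eq_sum]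
  simp only [Finset.sum_range_succ, Finset.sum_range_zero, h0, hb1, hb2, h3, h4]
  norm_num

/-- `H²(N; ℤ)/T` of a closed `4`-manifold is a finitely generated free `ℤ`-module (Hatcher
2002, §3.3 p. 250 with Cor. A.8–A.9; the tree's `finite_freeCohomology`, `free_freeCohomology`).
[cite: HatcherAT2002, §3.3 p. 250] -/
theorem finite_and_free_freeCohomology_two :
    Module.Finite ℤ (freeCohomology ℤ N 2) ∧ Module.Free ℤ (freeCohomology ℤ N 2) :=
  ⟨finite_freeCohomology (finite_singularCohomology_of_compactSpace_of_isPrincipalIdealRing ℤ N 4 2),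
    free_freeCohomology (finite_singularCohomology_of_compactSpace_of_isPrincipalIdealRing ℤ N 4 2)⟩

/-- **The rank-one lattice of a door.** For a closed `ℤ`-oriented `4`-manifold with
`rank H₂(N; ℤ) = 1` and `b⁺(μ) ≥ 1` there is a
coordinate `e : H²(N; ℤ)/T ≃ ℤ` in which the intersection form is
`Q(x, y) = e(x) e(y)` — the odd unimodular lattice `⟨+1⟩` (Milnor–Husemoller 1973, §I.2, §V.1;
unimodularity is the tree's proved `isPerfPair_cupPairingModTorsion_holds`).
[cite: MilnorHusemoller1973, §I.2 and §V.1] -/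
theorem exists_linearEquiv_intersectionForm_of_door (μ : HomologicalOrientation ℤ N 4)
    (hpos : 1 ≤ sigPos (intersectionForm two_add_two_eq_four μ).toQuadraticMap)
    (hb2 : Module.finrank ℤ (singularHomology ℤ ℤ N 2) = 1) :
    ∃ e : freeCohomology ℤ N 2 ≃ₗ[ℤ] ℤ,
      ∀ x y, intersectionForm two_add_two_eq_four μ x y = e x * e y := by
  obtain ⟨hfin, hfree⟩ := finite_and_free_freeCohomology_two (N := N)
  obtain ⟨e⟩ := nonempty_linearEquiv_int_of_finrank_eq_one (finrank_freeCohomology_two_eq_one hb2)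
  have hperf : (intersectionForm two_add_two_eq_four μ).IsPerfPair :=
    isPerfPair_intersectionForm two_add_two_eq_four μ isPerfPair_cupPairingModTorsion_holds
  have h1 := apply_generator_self_eq_one _ hperf hpos e
  exact ⟨e, fun x y ↦ by rw [bilin_apply_eq_of_linearEquiv _ e x y, h1, mul_one]⟩

end Door

/-- **Registered sub-goal `stub_taubesCanonicalCurve_doorLattice`** (one-line conjunction of the
door numerics: `σ = 1`, `χ = -1`, `dim_ℚ H²(N; ℚ) = 1`, and the coordinate `e : H²(N; ℤ)/T ≃ ℤ`
with `Q(x, y) = e(x) e(y)`). [cite: MilnorHusemoller1973, §I.2 and §V.1] -/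
theorem stub_taubesCanonicalCurve_doorLattice : ∀ (N : Type) [TopologicalSpace N] [T2Space N] [CompactSpace N] [ConnectedSpace N] [ChartedSpace (EuclideanSpace ℝ (Fin 4)) N] (μ : HomologicalOrientation ℤ N 4), 1 ≤ sigPos (intersectionForm two_add_two_eq_four μ).toQuadraticMap → Module.finrank ℤ (singularHomology ℤ ℤ N 1) = 2 → Module.finrank ℤ (singularHomology ℤ ℤ N 2) = 1 → μ.signature = 1 ∧ relEuler ℤ ℤ N ∅ = -1 ∧ Module.finrank ℚ (singularCohomology ℚ ℚ N 2) = 1 ∧ ∃ e : freeCohomology ℤ N 2 ≃ₗ[ℤ] ℤ, ∀ x y, intersectionForm two_add_two_eq_four μ x y = e x * e y :=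
  fun _ _ _ _ _ _ μ hpos hb1 hb2 ↦ ⟨signature_eq_one_of_door μ hpos hb2,
    relEuler_eq_neg_one_of_door μ hb1 hb2, finrank_rat_singularCohomology_two_eq_one hb2,
    exists_linearEquiv_intersectionForm_of_door μ hpos hb2⟩

end Summit.SmoothPoincare4.SmoothPoincare4.Theorems.NoGenusTwoDoor.CanonicalCapFilling
end
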